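import Summits.PneNP.PneNP.Theorems.OneSliceConstantBandTransferStepAux
import Literature.Computability.Complexity.RossmanMonotoneCliqueGraphs
import Literature.Computability.Complexity.CliqueThresholdBounds
import Summits.PneNP.PneNP.Theorems.OneSliceConstantBandNearCliqueContiguityCount

/-!
# Near-clique contiguity on a critical slice (S2 of the line `flat-prior-relative-minterms`), part 4: fibres

One-sided total variation from a second moment (Cauchy–Schwarz) and the overlap bound
`#{(x,A,e) : on(x) ∩ K_A ≠ ∅}·C(n,2) ≤ K²·i·#slice_i·C(n,k)` (union bound + hypergeometric tail). [folklore]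
-/

noncomputable section
namespace Summit.PneNP.PneNP.Cruxes.ConstantBand.FlatPriorRelativeMinterms

set_option linter.dupNamespace false

open Literature.Computability.Complexity Filter Classical
open Finset hiding slice
open Summit.PneNP.PneNP.Theorems.ConstantBand.Negative
open scoped Topology

section Window

set_option quotPrecheck false

variable {n : ℕ}

/-- The `k`-subsets of the vertex set. -/
local notation "𝒜⟦" n ", " k "⟧" => powersetCard k (univ : Finset (Fin n))

/-- The admissible pairs `(A, e)`: a `k`-set `A` and an edge `e` of `K_A`. -/
local notation "𝒫⟦" n ", " k "⟧" =>
  Finset.filter (fun ae : Finset (Fin n) × Edge n => ae.2 ∈ edgesIn ae.1)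
    ((powersetCard k (univ : Finset (Fin n))) ×ˢ (univ : Finset (Edge n)))

/-- The pattern of `(A, e)` in `y`: `K_A − e ⊆ on(y)` and `e ∉ on(y)`. -/
local notation "Pat⟦" A ", " e ", " y "⟧" =>
  ((∀ e' ∈ edgesIn A, e' ≠ e → y e' = true) ∧ y e = false)

/-- The near-clique count `X(y) = #{(A,e) : K_A − e ⊆ on(y), e ∉ on(y)}`. -/
local notation "Xc⟦" n ", " k ", " y "⟧" =>
  Finset.card (Finset.filter (fun ae : Finset (Fin n) × Edge n => Pat⟦ae.1, ae.2, y⟧) 𝒫⟦n, k⟧)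

/-- The threshold density `θ_k(n) = n^{-2/(k-1)}`. -/
local notation "θ⟦" k ", " n "⟧" => ((n : ℝ) ^ (-(2 : ℝ) / ((k : ℝ) - 1)))

/-- The real threshold `T_k(n) = C(n,2)·θ_k(n)` (`thr k n = ⌊T_k(n)⌋₊`). -/
local notation "T⟦" k ", " n "⟧" => (((Nat.choose n 2 : ℕ) : ℝ) * θ⟦k, n⟧)

/-! ### One-sided total variation from a second moment -/

/-- **One-sided total variation from a second moment** (Cauchy–Schwarz): if
`#s·Σ_s X² ≤ (1+δ²)·(Σ_s X)²` then every `S ⊆ s` has `Σ_S X ≤ (Σ_s X)·(#S/#s + δ)`. [folklore] -/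
theorem ncc_tv {ι : Type*} {s S : Finset ι} (hS : S ⊆ s) (X : ι → ℝ) (hX : ∀ y ∈ s, 0 ≤ X y)
    {δ : ℝ} (hδ : 0 ≤ δ) (hmom : (#s : ℝ) * ∑ y ∈ s, X y ^ 2 ≤ (1 + δ ^ 2) * (∑ y ∈ s, X y) ^ 2) :
    ∑ y ∈ S, X y ≤ (∑ y ∈ s, X y) * ((#S : ℝ) / #s + δ) := by
  rcases s.eq_empty_or_nonempty with rfl | hne
  · rw [subset_empty.1 hS]
    simp
  set M : ℝ := (#s : ℝ) with hM
  set Tot := ∑ y ∈ s, X y with hTot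
  have hMpos : 0 < M := by
    rw [hM]
    exact_mod_cast hne.card_pos
  have hTot0 : 0 ≤ Tot := sum_nonneg hX
  set μ := Tot / M with hμ
  have hCS : (∑ y ∈ s, |X y - μ|) ^ 2 ≤ M * ∑ y ∈ s, |X y - μ| ^ 2 := sq_sum_le_card_mul_sum_sq
  have hvar : M * ∑ y ∈ s, |X y - μ| ^ 2 = M * ∑ y ∈ s, X y ^ 2 - Tot ^ 2 := by
    simp_rw [sq_abs, sub_sq]
    rw [sum_add_distrib, sum_sub_distrib, sum_const, nsmul_eq_mul, ← hM]
    have h1 : ∑ y ∈ s, 2 * X y * μ = 2 * μ * Tot := by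
      rw [hTot, mul_sum]
      exact sum_congr rfl fun y _ => by ring
    rw [h1, hμ]
    field_simp
    ring
  have hdev : ∑ y ∈ s, |X y - μ| ≤ δ * Tot := by
    have h1 : (∑ y ∈ s, |X y - μ|) ^ 2 ≤ (δ * Tot) ^ 2 := by
      calc _ ≤ M * ∑ y ∈ s, |X y - μ| ^ 2 := hCS
        _ = M * ∑ y ∈ s, X y ^ 2 - Tot ^ 2 := hvar
        _ ≤ (1 + δ ^ 2) * Tot ^ 2 - Tot ^ 2 := by linarith
        _ = (δ * Tot) ^ 2 := by ring
    exact (sq_le_sq₀ (sum_nonneg fun y _ => abs_nonneg _) (mul_nonneg hδ hTot0)).1 h1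
  calc ∑ y ∈ S, X y = ∑ y ∈ S, (μ + (X y - μ)) := sum_congr rfl fun y _ => by ring
    _ = #S * μ + ∑ y ∈ S, (X y - μ) := by rw [sum_add_distrib, sum_const, nsmul_eq_mul]
    _ ≤ #S * μ + ∑ y ∈ S, |X y - μ| := by
        gcongr with y _
        exact le_abs_self _
    _ ≤ #S * μ + ∑ y ∈ s, |X y - μ| :=
        add_le_add (le_refl _) (sum_le_sum_of_subset_of_nonneg hS fun _ _ _ => abs_nonneg _)
    _ ≤ #S * μ + δ * Tot := by linarith
    _ = Tot * (#S / M + δ) := by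
        rw [hμ]
        field_simp

/-! ### The overlap event is rare and the planting map is injective off it -/

/-- Cardinality of a filtered product, fibrewise over the first factor. [folklore] -/
theorem ncc_card_filter_product' {α β : Type*} (s : Finset α) (t : Finset β) (p : α × β → Prop)
    [DecidablePred p] :
    #((s ×ˢ t).filter p) = ∑ a ∈ s, #(t.filter fun b => p (a, b)) := by
  rw [card_filter, sum_product]
  refine sum_congr rfl fun a _ => ?_
  rw [card_filter]

/-- **Overlap is rare**: `#{(x,A,e) : e ∈ K_A, on(x) ∩ K_A ≠ ∅}·C(n,2) ≤ K·K·i·#slice_i·C(n,k)`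
(union bound over the `K` edges of `K_A` and the hypergeometric tail `P_i[x_{e'}] ≤ i/C(n,2)`). [folklore] -/
theorem ncc_overlap_mul_le (k : ℕ) {i : ℕ} (hi : i ≤ n.choose 2) :
    #((((slice n i) ×ˢ 𝒜⟦n, k⟧) ×ˢ (univ : Finset (Edge n))).filter fun t =>
        t.2 ∈ edgesIn t.1.2 ∧ ∃ e' ∈ edgesIn t.1.2, t.1.1 e' = true) * n.choose 2 ≤
      k.choose 2 * k.choose 2 * i * #(slice n i) * n.choose k := by
  rw [ncc_card_filter_product']
  have hK : ∀ A ∈ 𝒜⟦n, k⟧, #(edgesIn A) = k.choose 2 := fun A hA => by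
    rw [ncc_edgesIn_eq_filter, card_filter_cliqueVec, (mem_powersetCard.1 hA).2]
  have h1 : ∀ xA ∈ (slice n i) ×ˢ 𝒜⟦n, k⟧,
      #((univ : Finset (Edge n)).filter fun e =>
        e ∈ edgesIn xA.2 ∧ ∃ e' ∈ edgesIn xA.2, xA.1 e' = true) ≤
        k.choose 2 * ∑ e' ∈ edgesIn xA.2, (if xA.1 e' = true then 1 else 0) := by
    intro xA hxA
    obtain ⟨-, hA⟩ := mem_product.1 hxA
    by_cases hex : ∃ e' ∈ edgesIn xA.2, xA.1 e' = true
    · obtain ⟨e', he', hxe'⟩ := hex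
      have hs : 1 ≤ ∑ e'' ∈ edgesIn xA.2, (if xA.1 e'' = true then 1 else 0) := by
        have := single_le_sum (f := fun e'' => if xA.1 e'' = true then 1 else 0)
          (fun _ _ => Nat.zero_le _) he'
        rwa [if_pos hxe'] at this
      calc #((univ : Finset (Edge n)).filter fun e =>
            e ∈ edgesIn xA.2 ∧ ∃ e' ∈ edgesIn xA.2, xA.1 e' = true)
          ≤ #(edgesIn xA.2) := card_le_card fun e he => (mem_filter.1 he).2.1
        _ = k.choose 2 := hK _ hA
        _ ≤ _ := Nat.le_mul_of_pos_right _ hs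
    · have h0 : ((univ : Finset (Edge n)).filter fun e =>
          e ∈ edgesIn xA.2 ∧ ∃ e' ∈ edgesIn xA.2, xA.1 e' = true) = ∅ :=
        filter_eq_empty_iff.2 fun e _ h => hex h.2
      rw [h0, card_empty]
      exact Nat.zero_le _
  have htail : ∀ e' : Edge n, #((slice n i).filter fun x => x e' = true) * n.choose 2 ≤ i * #(slice n i) := by
    intro e'
    have h := ts_card_slice_filter_supset_mul_le ({e'} : Finset (Edge n)) hi
    rw [card_singleton, pow_one, pow_one] at h
    refine le_trans (Nat.mul_le_mul_right _ (card_le_card fun x hx => ?_)) h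
    rw [mem_filter] at hx ⊢
    exact ⟨hx.1, fun e he => by rw [mem_singleton.1 he]; exact hx.2⟩
  calc (∑ xA ∈ (slice n i) ×ˢ 𝒜⟦n, k⟧, #((univ : Finset (Edge n)).filter fun e =>
          e ∈ edgesIn xA.2 ∧ ∃ e' ∈ edgesIn xA.2, xA.1 e' = true)) * n.choose 2
      ≤ (∑ xA ∈ (slice n i) ×ˢ 𝒜⟦n, k⟧,
          k.choose 2 * ∑ e' ∈ edgesIn xA.2, (if xA.1 e' = true then 1 else 0)) * n.choose 2 :=
        Nat.mul_le_mul_right _ (sum_le_sum h1)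
    _ = k.choose 2 * ((∑ A ∈ 𝒜⟦n, k⟧, ∑ e' ∈ edgesIn A,
          ∑ x ∈ slice n i, (if x e' = true then 1 else 0)) * n.choose 2) := by
        rw [← mul_sum, sum_product, sum_comm]
        simp_rw [sum_comm (s := slice n i)]
        ring
    _ = k.choose 2 * ∑ A ∈ 𝒜⟦n, k⟧, ∑ e' ∈ edgesIn A,
          #((slice n i).filter fun x => x e' = true) * n.choose 2 := by
        congr 1
        rw [sum_mul]
        refine sum_congr rfl fun A _ => ?_
        rw [sum_mul]
        refine sum_congr rfl fun e' _ => ?_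
        rw [card_filter]
    _ ≤ k.choose 2 * ∑ A ∈ 𝒜⟦n, k⟧, ∑ _e' ∈ edgesIn A, i * #(slice n i) :=
        Nat.mul_le_mul_left _ (sum_le_sum fun A _ => sum_le_sum fun e' _ => htail e')
    _ = k.choose 2 * (n.choose k * (k.choose 2 * (i * #(slice n i)))) := by
        congr 1
        rw [sum_congr rfl fun A hA => by rw [sum_const, smul_eq_mul, hK A hA], sum_const, smul_eq_mul,
          card_powersetCard, card_univ, Fintype.card_fin]
    _ = _ := by ring

/-- **Registered sub-goal of the Fibres file** (the overlap event is rare, `∀`-form of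
`ncc_overlap_mul_le`). [folklore] -/
theorem ncc_fibres_overlap :
    ∀ n k i : ℕ, i ≤ n.choose 2 →
      #((((slice n i) ×ˢ powersetCard k (univ : Finset (Fin n))) ×ˢ (univ : Finset (Edge n))).filter
          fun t => t.2 ∈ edgesIn t.1.2 ∧ ∃ e' ∈ edgesIn t.1.2, t.1.1 e' = true) * n.choose 2 ≤
        k.choose 2 * k.choose 2 * i * #(slice n i) * n.choose k :=
  fun _ k _ hi => ncc_overlap_mul_le k hi

end Window

end Summit.PneNP.PneNP.Cruxes.ConstantBand.FlatPriorRelativeMinterms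

end
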